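import Literature.MathematicalPhysics.QuantumFieldTheory.BalabanImbrieJaffe1984to88.BIJ88Eq5514Torus

/-!
# `BalabanImbrieJaffe1984to88.BIJ88Eq5514ZTorus` — T. Bałaban, J. Imbrie, A. Jaffe, *Effective action and cluster properties of the abelian
Higgs model*, Commun. Math. Phys. **114** (1988) 257–315 [BalabanImbrieJaffe1988], Sect. 5.5 p. 285 [PDF 29], the sentence after (5.5.14):
*"The same formula holds in Λ̄₅^{(k)*} for the gauge field in the normalization factors, except that we have w₅ instead of w₁"* — ON THE TORUS
CARRIER OF RECORD (kind «model instance»): the background gauge field (5.4.10) of the normalization factors after the second translation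
(5.5.2), deep inside `Λ₃^{(k)}`, is `(Q^{s*}_{k+1}v) exp ie_kη[H_{k,loc}A^{(k)} − L^{−2}𝒟^η_{k+1,loc}∂*Q^{e*}_{k+1}f + w₅A′]`; together with (5.5.11)
in the bookkeeping (2.12) (`𝒟_{k,loc} = Σ_{j<k} H_{j,loc}C^{(j)}_{loc}H*_{j,loc}`) as a torus operator identity.

statement-level skeleton of published theorems with citation tags; proofs where landed; nothing here is a claim about the Yang–Mills mass gap

PDF held: `paper:balaban1988-cmp114-bij-abelian-higgs-effective-action` (journal page = PDF page + 256); p. 285 [PDF 29] rendered and read as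
an image this session (seat folder `renders/original-p029-x2.png`), p. 283 [PDF 27] ((5.4.9)–(5.4.10), (5.5.2)) =
`HOME/lit-balaban-r16/renders/cmp114/original-p027-x2.png`, p. 261 [PDF 5] ((2.12)) = `original-p005-x2.png`.

CITATION HEADER (lean-in-tree rule).  Part of the lit-balaban TYPED SKELETON (HOME `run/shared/lean/pub/lit-balaban/`), PHASE-2 proof
seat p31 gen 8 (unit `lit-balaban-p31-g8`; third file of the gen after `BIJ88Eq5514Torus` p299521 and `BIJ88Eq534Locality`; TAKING line
HOME/STATUS.md 2026-08-21T18:59:30Z).  WHAT IS REPRODUCED: row `C2.Eq5.5.13-5.5.14` of `HOME/lit-balaban-r16/ROWS-C2-part2.md` (owner r16),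
the quoted `w₅` sentence; row `C2.Eq5.5.1-5.5.12`, member (5.5.11) in the (2.12) bookkeeping at the torus level (r16's ring identity
`BIJ88Sect5StatementsPart3.eq5511`); row `C2.Eq5.4.8-5.4.10`, (5.4.10) restricted to a bond of `Λ̄₂^{(k)*}` free of the off-`Λ̄₂*` range law.

THE PRINTED TEXT (verbatim).  p. 283: *"We can gauge away the term ∂C_kΛ₃^{(k)*}A′, leaving us with the following background gauge field for the
normalization factors: (Λ̄₂^{(k)*c}u_k)(Λ̄₂^{(k)*}Q^{s*}_{k+1}v) exp ie_kη[Λ̄₂^{(k)*}(Q^{s*}_k − 𝒟_{k,loc}∂Q^{e*}_k∂)Λ₃^{(k)*c}A′ − L^{−2}Λ̄₂^{(k)*}𝒟_{k,loc}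
∂*Q^{e*}_{k+1}f + H_{k,loc}Λ₃^{(k)*}A′ + w₅A′]. (5.4.10)"*; p. 285: *"u′_k = (Q^{s*}_{k+1}v) exp ie_kη[H_{k,loc}A^{(k)} − L^{−2}𝒟^η_{k+1,loc}∂*Q^{e*}_{k+1}f +
w₁A′]. (5.5.14) The same formula holds in Λ̄₅^{(k)*} for the gauge field in the normalization factors, except that we have w₅ instead of w₁."*;
p. 261: *"𝒟_{k,loc} = Σ_{j=0}^{k−1} H^{L^jη}_{j,loc}C^{(j),L^jη}_{loc}H^{*L^j}_{j,loc} ≡ Σ_{j=0}^{k−1} G^{(j),η}_{loc}. (2.12)"*; p. 285: *"𝒟_{k,loc} +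
H_{k,loc}C^{(k)}_{loc}H*_{k,loc} = 𝒟^η_{k+1,loc}, (5.5.11)"*.

WHAT THESE ARE, and what is data (as in `BIJ88Eq5514Torus`; nothing new).  (5.4.10) INSIDE `Λ̄₂^{(k)*}`: at a bond `b ∈ Λ̄₁^{(k)*}` the
background field (5.3.3) is `(Q^{s*}_{k+1}v) exp ie_kη[Q^{s*}_kA′ − g]` (gen 6's `eq533_inside`), `g(b) = T_loc(∂A′ + L^{−2}Q^{e*}f)(b)` (`hT`, the
(5.3.4) locality — PROVED for the actual exponent by `BIJ88Eq534Locality.locality534`), the splitting (5.4.9) at `Λ₃^{(k)*} = S` is linear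
algebra from (5.4.1) (`h541`) — no range law is needed AT a bond of `Λ̄₂*` (gen 7's `eq549_torus`/`eq5410_torus` carry `hrange` only to
describe the field OFF `Λ̄₂*`) — and the gauge transformation `bgGaugeU e_k η (C_k(Λ₃*A′))` removes `∂C_kΛ₃*A′` exactly: `eq5410_inside`.
THE `w₅` SENTENCE then needs at the bond `b` (*"in Λ̄₅^{(k)*}"*, three collars inside `Λ₂`): the first bracket term `(Q^{s*}_k −
T_loc∂)(Λ₃^{*c}A′)` vanishes at `b` (hypothesis `hfar3`, DERIVED from range relations in `far3_of_range`: the k-block bond of `b` lies in `Λ₃*`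
and every plaquette within the range of `T_loc` at `b` has its bonds in `Λ₃*`), `H_{k,loc}(Λ₃*A′)(b) = H_{k,loc}A′(b)` (hypothesis `hS3`, from
the range of `H_{k,loc}` by `BIJ88Eq5514Torus.cutoff4_invisible_printed` read with `Λ₃*` for `Λ₄*`), and then exactly the three facts of
(5.5.14): the change of variables `A′ = A^{(k)} − L^{−2}V`, `hΛ₄`, `h5511`.  (5.5.11) FROM (2.12): for operator families `H_{j,loc} : unit(j)-bond
→ η-bond`, `C^{(j)}_{loc}`, `H*_{j,loc}` on the tori (base level `i`, `j`-th unit lattice = level `i + j`), the localized propagator of (2.12)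
is the endomorphism `Σ_{j<k} H_{j,loc}C^{(j)}_{loc}H*_{j,loc}` of the η-bond functions, and (5.5.11) is `Finset.sum_range_succ` —
`h5511_of_sum212` supplies the hypothesis `h5511` of `BIJ88Eq5514Torus.eq5514_torus`/`eq566_torus` and of `eq5514Z_torus` for these data.

WHAT IS PROVED (theorems only; 0 `sorry`, standard axioms, no `def`, no `Prop`-valued fact introduced).
* §1 **`h5511_of_sum212`** ((5.5.11) for `𝒟_{k,loc} := Σ_{j<k} H_{j,loc}C^{(j)}_{loc}H*_{j,loc}` of (2.12), dependent operator families on the tori).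
* §2 `bracket549_at` ((5.4.9) at one bond, from `h541` alone), **`eq5410_inside`** ((5.4.10) at a bond of `Λ̄₁^{(k)*} ⊇ Λ̄₂^{(k)*}`).
* §3 **`eq5514Z_torus`** (the `w₅` sentence: bracket `H_{k,loc}A^{(k)} − L^{−2}𝒟^η_{k+1,loc}X_f + w₅A′`, `w₅A′ = (T_k − 𝒟_{k,loc}S)∂(Λ₃*A′) + (H_k −
  H_{k,loc})(Λ₃*A′)` as in gen 7, `A′ = A^{(k)} − L^{−2}V`), `far3_of_range` (the hypothesis `hfar3` from range relations).
HONEST SCOPE.  Not here: bounds on `w₅` (p08's `BIJ88W5Bound549`), the radii of `Λ₂ ⊃ Λ₃ ⊃ Λ₄ ⊃ Λ₅` (membership ∕ range hypotheses), the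
rescalings `L^jη` of (2.12) (absorbed in the data `H_{j,loc}`, as in r16's `curlyDloc`), the later removal of `w₅A′` (§5.7).  Import: this
seat's `BIJ88Eq5514Torus` (p299521).  Unit `lit-balaban-p31` (literature-prover-lit-balaban-p31-g8-0), 2026-08-21.
-/

namespace Literature.MathematicalPhysics.QuantumFieldTheory.BalabanImbrieJaffe1984to88.BIJ88Eq5514ZTorus

open Literature.MathematicalPhysics.QuantumFieldTheory.Balaban1983to89
open BIJ88Sect3Statements (U1 toC starB mem_starB starP)
open BIJ88Sect4Statements (backgroundU bgGaugeU)
open BIJ88Sect5StatementsPart3 (bgExp)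
open BIJ85BlockAveragesTorus (expU1 surfMul)
open BIJ85Eq453GaugeField (qsstarGIter)
open BIJ85Eq224Proof (torusBlockBondsIter)
open BIJ88Eq536Linearization (cutoff)
open BIJ88Eq533Torus (blockUnion eq533_inside)
open BIJ88Eq542Torus (Qsstar_indicator Qsstar_indicator_compl_add)
open BIJ88Eq5410Torus (curl_indicator_compl_add)
open BIJ88Eq5514Torus (h5511_apply)
open B7SectAStatements (blockOfIter)
open LatticeFieldCalculus (grad curl)
open scoped BigOperators Real
open Complex Finset

noncomputable section

variable {P : Params} {i : ℕ}

/-! ## §1 (5.5.11) in the bookkeeping (2.12), as a torus operator identity -/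

/-- **(5.5.11) from (2.12) ON THE TORUS.**  p. 261 [PDF 5]: *"𝒟_{k,loc} = Σ_{j=0}^{k−1} H^{L^jη}_{j,loc}C^{(j),L^jη}_{loc}H^{*L^jη}_{j,loc} (2.12)"*;
p. 285 [PDF 29]: *"𝒟_{k,loc} + H_{k,loc}C^{(k)}_{loc}H*_{k,loc} = 𝒟^η_{k+1,loc}, (5.5.11)"*.  For operator FAMILIES on the tori with base level `i`
(η-lattice) and `j`-th unit lattice = level `i + j` — `H_{j,loc}` : unit-bond functions → η-bond functions, `C^{(j)}_{loc}` on unit-bond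
functions, `H*_{j,loc}` : η-bond functions → unit-bond functions (the rescalings `L^jη` absorbed in the data) — the (2.12) sums are
endomorphisms of the η-bond functions and (5.5.11) is the recursion `Σ_{j<k+1} = Σ_{j<k} + (j = k)` (r16's `eq5511` in the ring
`curlyDloc`): the hypothesis `h5511` of `BIJ88Eq5514Torus.eq5514_torus` for these data. [cite: BalabanImbrieJaffe1988, (5.5.11) p.285] -/
theorem h5511_of_sum212 (Hl : (j : ℕ) → ((PBond P (i + j) → ℝ) →ₗ[ℝ] (PBond P i → ℝ)))
    (Cl : (j : ℕ) → ((PBond P (i + j) → ℝ) →ₗ[ℝ] (PBond P (i + j) → ℝ)))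
    (Hsl : (j : ℕ) → ((PBond P i → ℝ) →ₗ[ℝ] (PBond P (i + j) → ℝ))) (k : ℕ) :
    (∑ j ∈ Finset.range k, Hl j ∘ₗ Cl j ∘ₗ Hsl j) + Hl k ∘ₗ Cl k ∘ₗ Hsl k =
      ∑ j ∈ Finset.range (k + 1), Hl j ∘ₗ Cl j ∘ₗ Hsl j := by
  rw [Finset.sum_range_succ]

/-! ## §2 (5.4.9) at one bond and (5.4.10) inside `Λ̄₂^{(k)*}` -/

/-- kernel: **(5.4.9) AT ONE BOND, from (5.4.1) alone**: `(Q^{s*}_k − T_loc∂)A′ = (Q^{s*}_k − T_loc∂)(Λ₃^{*c}A′) + H_{k,loc}(Λ₃*A′) + ∂^ηC_k(Λ₃*A′) +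
w₅A′` at `b`, `w₅A′ = (T_k − T_loc)∂(Λ₃*A′) + (H_k − H_{k,loc})(Λ₃*A′)` (the range law of gen 7's `eq549_torus` is needed only OFF `Λ̄₂*`).
[cite: BalabanImbrieJaffe1988, (5.4.9) p.283] -/
theorem bracket549_at {k : ℕ} (hk : i + k ≤ P.m + P.K) {η : ℝ} (Tk Tloc : (Balaban1983to89.Plaq P (i + k) → ℝ) →ₗ[ℝ] (PBond P i → ℝ))
    (Hk Hloc : (PBond P (i + k) → ℝ) →ₗ[ℝ] (PBond P i → ℝ)) (Ck : (PBond P (i + k) → ℝ) →ₗ[ℝ] (Balaban1983to89.Site P i → ℝ))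
    (h541 : ∀ (B : PBond P (i + k) → ℝ) (b : PBond P i),
      (torusBlockBondsIter P i k).Qsstar B b - Tk (curl 1 B) b = Hk B b + grad η⁻¹ (Ck B) b)
    (S : Finset (PBond P (i + k))) (A' : PBond P (i + k) → ℝ) (b : PBond P i) :
    (torusBlockBondsIter P i k).Qsstar A' b - Tloc (curl 1 A') b =
      ((torusBlockBondsIter P i k).Qsstar ((↑Sᶜ : Set (PBond P (i + k))).indicator A') b -
          Tloc (curl 1 ((↑Sᶜ : Set (PBond P (i + k))).indicator A')) b) +
        Hloc ((↑S : Set (PBond P (i + k))).indicator A') b + grad η⁻¹ (Ck ((↑S : Set (PBond P (i + k))).indicator A')) b +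
        ((Tk (curl 1 ((↑S : Set (PBond P (i + k))).indicator A')) b - Tloc (curl 1 ((↑S : Set (PBond P (i + k))).indicator A')) b) +
          (Hk ((↑S : Set (PBond P (i + k))).indicator A') b - Hloc ((↑S : Set (PBond P (i + k))).indicator A') b)) := by
  have h3 := h541 ((↑S : Set (PBond P (i + k))).indicator A') b
  have hQ := Qsstar_indicator_compl_add hk S A' b
  have hC : Tloc (curl 1 ((↑Sᶜ : Set (PBond P (i + k))).indicator A')) b + Tloc (curl 1 ((↑S : Set (PBond P (i + k))).indicator A')) b =
      Tloc (curl 1 A') b := by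
    have hsum : curl 1 ((↑Sᶜ : Set (PBond P (i + k))).indicator A') + curl 1 ((↑S : Set (PBond P (i + k))).indicator A') =
        curl 1 A' := funext (curl_indicator_compl_add 1 S A')
    rw [← Pi.add_apply, ← map_add, hsum]
  linarith

/-- **(5.4.10) INSIDE `Λ̄₂^{(k)*}`.**  p. 283 [PDF 27]: *"We can gauge away the term ∂C_kΛ₃^{(k)*}A′, leaving us with the following background gauge
field for the normalization factors: (Λ̄₂^{(k)*c}u_k)(Λ̄₂^{(k)*}Q^{s*}_{k+1}v) exp ie_kη[Λ̄₂^{(k)*}(Q^{s*}_k − 𝒟_{k,loc}∂Q^{e*}_k∂)Λ₃^{(k)*c}A′ − L^{−2}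
Λ̄₂^{(k)*}𝒟_{k,loc}∂*Q^{e*}_{k+1}f + H_{k,loc}Λ₃^{(k)*}A′ + w₅A′]. (5.4.10)"*  HERE at ONE η-bond `b ∈ Λ̄₁^{(k)*}` (⊇ `Λ̄₂^{(k)*}`): the (4.16)
transformation `bgGaugeU` with gauge function `C_k(Λ₃*A′)` of the translated background field (gen 6's `eq533_inside`, data `u′ = e^{ie_kA′}` on
`Λ₁*`, `v`, `g`, `ηL^k = 1`; `hT` = the (5.3.4) locality at `b`) equals `(Q^{s*}_{k+1}v)(b) · exp ie_kη[(Q^{s*}_k − T_loc∂)(Λ₃^{*c}A′) −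
L^{−2}T_loc(Q^{e*}f) + H_{k,loc}(Λ₃*A′) + w₅A′](b)` — from `h541` alone (standing range). [cite: BalabanImbrieJaffe1988, (5.4.10) p.283] -/
theorem eq5410_inside {k : ℕ} (hk : i + k + 1 ≤ P.m + P.K) {ek η : ℝ} (hη : η * (P.L : ℝ) ^ k = 1)
    (X : Finset (Balaban1983to89.Site P (i + k + 1))) {u' : GaugeField P (i + k) U1} {A' : PBond P (i + k) → ℝ}
    (hu : ∀ c ∈ starB (blockUnion 1 X), u' c = expU1 (ek * A' c)) (v : GaugeField P (i + k + 1) U1) (g : PBond P i → ℝ)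
    {Plc : Type*} (L : ℝ) (Tk Tloc : (Balaban1983to89.Plaq P (i + k) → ℝ) →ₗ[ℝ] (PBond P i → ℝ))
    (Hk Hloc : (PBond P (i + k) → ℝ) →ₗ[ℝ] (PBond P i → ℝ)) (Ck : (PBond P (i + k) → ℝ) →ₗ[ℝ] (Balaban1983to89.Site P i → ℝ))
    (h541 : ∀ (B : PBond P (i + k) → ℝ) (b : PBond P i),
      (torusBlockBondsIter P i k).Qsstar B b - Tk (curl 1 B) b = Hk B b + grad η⁻¹ (Ck B) b)
    (Qes : (Plc → ℝ) →ₗ[ℝ] (Balaban1983to89.Plaq P (i + k) → ℝ)) (f : Plc → ℝ) (S : Finset (PBond P (i + k)))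
    {b : PBond P i} (hb₁ : b ∈ starB (blockUnion (k + 1) X)) (hT : g b = Tloc (curl 1 A' + L⁻¹ ^ 2 • Qes f) b) :
    bgGaugeU ek η (Ck ((↑S : Set (PBond P (i + k))).indicator A'))
        (backgroundU ek η (fun b => toC (qsstarGIter k (surfMul u' (cutoff (starB X) v)) b)) g) b =
      bgExp ek η (fun b => toC (qsstarGIter (k + 1) v b))
        (fun b => ((torusBlockBondsIter P i k).Qsstar ((↑Sᶜ : Set (PBond P (i + k))).indicator A') b -
            Tloc (curl 1 ((↑Sᶜ : Set (PBond P (i + k))).indicator A')) b) - L⁻¹ ^ 2 * Tloc (Qes f) b +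
          Hloc ((↑S : Set (PBond P (i + k))).indicator A') b +
          ((Tk (curl 1 ((↑S : Set (PBond P (i + k))).indicator A')) b - Tloc (curl 1 ((↑S : Set (PBond P (i + k))).indicator A')) b) +
            (Hk ((↑S : Set (PBond P (i + k))).indicator A') b - Hloc ((↑S : Set (PBond P (i + k))).indicator A') b))) b := by
  have h533 := eq533_inside hk hη X hu v g hb₁
  have h549 := bracket549_at (i := i) (k := k) (by omega) Tk Tloc Hk Hloc Ck h541 S A' b
  have hg : g b = Tloc (curl 1 A') b + L⁻¹ ^ 2 * Tloc (Qes f) b := by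
    rw [hT, map_add, map_smul, Pi.add_apply, Pi.smul_apply, smul_eq_mul]
  -- the real identity of the exponents: (5.3.4) bracket minus the gauge term = the (5.4.10) bracket
  have key : ek * η * ((torusBlockBondsIter P i k).Qsstar A' b - g b) +
      -(ek * η * grad η⁻¹ (Ck ((↑S : Set (PBond P (i + k))).indicator A')) b) =
      ek * η * (((torusBlockBondsIter P i k).Qsstar ((↑Sᶜ : Set (PBond P (i + k))).indicator A') b -
            Tloc (curl 1 ((↑Sᶜ : Set (PBond P (i + k))).indicator A')) b) - L⁻¹ ^ 2 * Tloc (Qes f) b +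
          Hloc ((↑S : Set (PBond P (i + k))).indicator A') b +
          ((Tk (curl 1 ((↑S : Set (PBond P (i + k))).indicator A')) b - Tloc (curl 1 ((↑S : Set (PBond P (i + k))).indicator A')) b) +
            (Hk ((↑S : Set (PBond P (i + k))).indicator A') b - Hloc ((↑S : Set (PBond P (i + k))).indicator A') b))) := by
    rw [hg]
    linear_combination (ek * η) * h549
  have keyC := congrArg (fun r : ℝ => (r : ℂ)) key
  simp only [bgGaugeU]
  rw [h533]
  simp only [bgExp]
  rw [mul_assoc, ← Complex.exp_add]
  congr 1
  congr 1
  push_cast at keyC ⊢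
  linear_combination I * keyC

/-! ## §3 *"The same formula holds in Λ̄₅^{(k)*} … except that we have w₅ instead of w₁"* -/

/-- kernel: **the hypothesis `hfar3` from range relations** — if the k-block bond of `b` lies in `Λ₃* = S` (so `Q^{s*}_k(Λ₃^{*c}A′)(b) = 0`,
`BIJ88Eq542Torus.Qsstar_indicator`) and every plaquette `near b` — the RANGE of `T_loc = 𝒟_{k,loc}S` at `b`, hypothesis `hT` — has its four bonds
in `S` (so `∂(Λ₃^{*c}A′)` vanishes there), then `(Q^{s*}_k − T_loc∂)(Λ₃^{*c}A′)(b) = 0`: *"in Λ̄₅^{(k)*}"*, three collars inside `Λ₂`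
(standing range). [cite: BalabanImbrieJaffe1988, (5.5.14) p.285] -/
theorem far3_of_range {k : ℕ} (hk : i + k ≤ P.m + P.K) (Tloc : (Balaban1983to89.Plaq P (i + k) → ℝ) →ₗ[ℝ] (PBond P i → ℝ))
    (near : PBond P i → Balaban1983to89.Plaq P (i + k) → Prop) {b : PBond P i}
    (hT : ∀ F₁ F₂ : Balaban1983to89.Plaq P (i + k) → ℝ, (∀ p, near b p → F₁ p = F₂ p) → Tloc F₁ b = Tloc F₂ b)
    (S : Finset (PBond P (i + k))) (hQ : (⟨blockOfIter k b.src, b.dir⟩ : PBond P (i + k)) ∈ S)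
    (hnear : ∀ p, near b p → (⟨p.src, p.μ⟩ : PBond P (i + k)) ∈ S ∧ (⟨p.src.shift p.μ, p.ν⟩ : PBond P (i + k)) ∈ S ∧
      (⟨p.src.shift p.ν, p.μ⟩ : PBond P (i + k)) ∈ S ∧ (⟨p.src, p.ν⟩ : PBond P (i + k)) ∈ S) (A' : PBond P (i + k) → ℝ) :
    (torusBlockBondsIter P i k).Qsstar ((↑Sᶜ : Set (PBond P (i + k))).indicator A') b -
      Tloc (curl 1 ((↑Sᶜ : Set (PBond P (i + k))).indicator A')) b = 0 := by
  rw [Qsstar_indicator hk, if_neg (fun h => (Finset.mem_compl.1 h) hQ)]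
  have hcurl : Tloc (curl 1 ((↑Sᶜ : Set (PBond P (i + k))).indicator A')) b = Tloc (curl 1 (fun _ => (0 : ℝ))) b := by
    refine hT _ _ fun p hp => ?_
    obtain ⟨h1, h2, h3, h4⟩ := hnear p hp
    have e : ∀ c : PBond P (i + k), c ∈ S → (↑Sᶜ : Set (PBond P (i + k))).indicator A' c = 0 := fun c hc =>
      Set.indicator_of_notMem (fun h => (Finset.mem_compl.1 (Finset.mem_coe.1 h)) hc) A'
    simp only [curl, e _ h1, e _ h2, e _ h3, e _ h4]
  have h0 : curl 1 (fun _ : PBond P (i + k) => (0 : ℝ)) = 0 := by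
    funext p
    simp [curl]
  rw [hcurl, h0, map_zero, Pi.zero_apply, sub_zero]

/-- **The `w₅` sentence ON THE TORUS.**  p. 285 [PDF 29], verbatim: *"u′_k = (Q^{s*}_{k+1}v) exp ie_kη[H_{k,loc}A^{(k)} − L^{−2}𝒟^η_{k+1,loc}∂*Q^{e*}_{k+1}
f + w₁A′]. (5.5.14) The same formula holds in Λ̄₅^{(k)*} for the gauge field in the normalization factors, except that we have w₅ instead of w₁."*
HERE: the gauge field (5.4.10) of the normalization factors at a bond `b ∈ Λ̄₁^{(k)*}` (`eq5410_inside`, with `T_loc = 𝒟_{k,loc} ∘ S`, `S =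
∂*Q^{e*}_k`, `X_f = S(Q^{e*}f)`) after the change of variables (5.5.2) `A′ = A^{(k)} − L^{−2}V`, under: `hfar3` (the `Λ₃^{*c}` term vanishes at
`b` — *"in Λ̄₅^{(k)*}"*, `far3_of_range`), `hS3` (`H_{k,loc}(Λ₃*A′)(b) = H_{k,loc}A′(b)`, range of `H_{k,loc}` inside `Λ₃*`,
`BIJ88Eq5514Torus.cutoff4_invisible_printed` read for `Λ₃*`), `hΛ₄` (`Λ₄*` invisible to `H_{k,loc}` at `b`) and (5.5.11) `h5511`.  CONCLUSION:
the field at `b` is `(Q^{s*}_{k+1}v)(b) · exp ie_kη[H_{k,loc}A^{(k)} − L^{−2}𝒟^η_{k+1,loc}X_f + w₅A′](b)`, `w₅A′ = (T_k − 𝒟_{k,loc}S)∂(Λ₃*A′) +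
(H_k − H_{k,loc})(Λ₃*A′)` spelled out (standing range). [cite: BalabanImbrieJaffe1988, (5.5.14) p.285] -/
theorem eq5514Z_torus {k : ℕ} (hk : i + k + 1 ≤ P.m + P.K) {ek η : ℝ} (hη : η * (P.L : ℝ) ^ k = 1)
    (X : Finset (Balaban1983to89.Site P (i + k + 1))) {u' : GaugeField P (i + k) U1} (A V : PBond P (i + k) → ℝ) (L : ℝ)
    (hu : ∀ c ∈ starB (blockUnion 1 X), u' c = expU1 (ek * (A - L⁻¹ ^ 2 • V) c)) (v : GaugeField P (i + k + 1) U1) (g : PBond P i → ℝ)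
    {Plc : Type*} (Tk : (Balaban1983to89.Plaq P (i + k) → ℝ) →ₗ[ℝ] (PBond P i → ℝ))
    (Dloc Dnext : (PBond P i → ℝ) →ₗ[ℝ] (PBond P i → ℝ)) (Sop : (Balaban1983to89.Plaq P (i + k) → ℝ) →ₗ[ℝ] (PBond P i → ℝ))
    (Hk Hloc : (PBond P (i + k) → ℝ) →ₗ[ℝ] (PBond P i → ℝ)) (Ck : (PBond P (i + k) → ℝ) →ₗ[ℝ] (Balaban1983to89.Site P i → ℝ))
    (Cloc : (PBond P (i + k) → ℝ) →ₗ[ℝ] (PBond P (i + k) → ℝ)) (Hsloc : (PBond P i → ℝ) →ₗ[ℝ] (PBond P (i + k) → ℝ))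
    (h541 : ∀ (B : PBond P (i + k) → ℝ) (b : PBond P i),
      (torusBlockBondsIter P i k).Qsstar B b - Tk (curl 1 B) b = Hk B b + grad η⁻¹ (Ck B) b)
    (h5511 : Dloc + Hloc ∘ₗ Cloc ∘ₗ Hsloc = Dnext)
    (Qes : (Plc → ℝ) →ₗ[ℝ] (Balaban1983to89.Plaq P (i + k) → ℝ)) (f : Plc → ℝ) (S₃ : Finset (PBond P (i + k)))
    {b : PBond P i} (hb₁ : b ∈ starB (blockUnion (k + 1) X))
    (hT : g b = Dloc (Sop (curl 1 (A - L⁻¹ ^ 2 • V) + L⁻¹ ^ 2 • Qes f)) b)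
    (hfar3 : (torusBlockBondsIter P i k).Qsstar ((↑S₃ᶜ : Set (PBond P (i + k))).indicator (A - L⁻¹ ^ 2 • V)) b -
      Dloc (Sop (curl 1 ((↑S₃ᶜ : Set (PBond P (i + k))).indicator (A - L⁻¹ ^ 2 • V)))) b = 0)
    (hS3 : Hloc ((↑S₃ : Set (PBond P (i + k))).indicator (A - L⁻¹ ^ 2 • V)) b = Hloc (A - L⁻¹ ^ 2 • V) b)
    (hΛ₄ : Hloc V b = Hloc (Cloc (Hsloc (Sop (Qes f)))) b) :
    bgGaugeU ek η (Ck ((↑S₃ : Set (PBond P (i + k))).indicator (A - L⁻¹ ^ 2 • V)))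
        (backgroundU ek η (fun b => toC (qsstarGIter k (surfMul u' (cutoff (starB X) v)) b)) g) b =
      bgExp ek η (fun b => toC (qsstarGIter (k + 1) v b))
        (fun b => Hloc A b - L⁻¹ ^ 2 * Dnext (Sop (Qes f)) b +
          ((Tk (curl 1 ((↑S₃ : Set (PBond P (i + k))).indicator (A - L⁻¹ ^ 2 • V))) b -
              Dloc (Sop (curl 1 ((↑S₃ : Set (PBond P (i + k))).indicator (A - L⁻¹ ^ 2 • V)))) b) +
            (Hk ((↑S₃ : Set (PBond P (i + k))).indicator (A - L⁻¹ ^ 2 • V)) b -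
              Hloc ((↑S₃ : Set (PBond P (i + k))).indicator (A - L⁻¹ ^ 2 • V)) b))) b := by
  -- (5.4.10) inside, with `T_loc = 𝒟_{k,loc} ∘ S` and `A′ = A − L⁻²V`
  have h5410 := eq5410_inside hk hη X hu v g L Tk (Dloc ∘ₗ Sop) Hk Hloc Ck h541 Qes f S₃ hb₁
    (by simpa only [LinearMap.coe_comp, Function.comp_apply] using hT)
  rw [h5410]
  have hHloc : Hloc (A - L⁻¹ ^ 2 • V) b = Hloc A b - L⁻¹ ^ 2 * Hloc V b := by
    rw [map_sub, map_smul, Pi.sub_apply, Pi.smul_apply, smul_eq_mul]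
  have h11 := h5511_apply Dloc Dnext Hloc Cloc Hsloc h5511 (Sop (Qes f)) b
  have hfar3' : (torusBlockBondsIter P i k).Qsstar ((↑S₃ᶜ : Set (PBond P (i + k))).indicator (A - L⁻¹ ^ 2 • V)) b -
      (Dloc ∘ₗ Sop) (curl 1 ((↑S₃ᶜ : Set (PBond P (i + k))).indicator (A - L⁻¹ ^ 2 • V))) b = 0 := by
    simpa only [LinearMap.coe_comp, Function.comp_apply] using hfar3
  -- the real identity of the two brackets at `b`
  have key : ((torusBlockBondsIter P i k).Qsstar ((↑S₃ᶜ : Set (PBond P (i + k))).indicator (A - L⁻¹ ^ 2 • V)) b -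
            (Dloc ∘ₗ Sop) (curl 1 ((↑S₃ᶜ : Set (PBond P (i + k))).indicator (A - L⁻¹ ^ 2 • V))) b) -
          L⁻¹ ^ 2 * (Dloc ∘ₗ Sop) (Qes f) b +
        Hloc ((↑S₃ : Set (PBond P (i + k))).indicator (A - L⁻¹ ^ 2 • V)) b +
        ((Tk (curl 1 ((↑S₃ : Set (PBond P (i + k))).indicator (A - L⁻¹ ^ 2 • V))) b -
            (Dloc ∘ₗ Sop) (curl 1 ((↑S₃ : Set (PBond P (i + k))).indicator (A - L⁻¹ ^ 2 • V))) b) +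
          (Hk ((↑S₃ : Set (PBond P (i + k))).indicator (A - L⁻¹ ^ 2 • V)) b -
            Hloc ((↑S₃ : Set (PBond P (i + k))).indicator (A - L⁻¹ ^ 2 • V)) b)) =
      Hloc A b - L⁻¹ ^ 2 * Dnext (Sop (Qes f)) b +
        ((Tk (curl 1 ((↑S₃ : Set (PBond P (i + k))).indicator (A - L⁻¹ ^ 2 • V))) b -
            Dloc (Sop (curl 1 ((↑S₃ : Set (PBond P (i + k))).indicator (A - L⁻¹ ^ 2 • V)))) b) +
          (Hk ((↑S₃ : Set (PBond P (i + k))).indicator (A - L⁻¹ ^ 2 • V)) b -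
            Hloc ((↑S₃ : Set (PBond P (i + k))).indicator (A - L⁻¹ ^ 2 • V)) b)) := by
    rw [hfar3']
    simp only [LinearMap.coe_comp, Function.comp_apply]
    rw [hS3, hHloc, hΛ₄]
    linear_combination (-(L⁻¹ ^ 2)) * h11
  simp only [bgExp]
  rw [key]

end

end Literature.MathematicalPhysics.QuantumFieldTheory.BalabanImbrieJaffe1984to88.BIJ88Eq5514ZTorus
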